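import Mathlib
import Summits.MatrixMultiplication.Statement
import Summits.MatrixMultiplication.MatrixMultiplication.Theorems.GraphEquationsSystems
import Summits.MatrixMultiplication.MatrixMultiplication.Theorems.GraphEquationsKernel
import Summits.MatrixMultiplication.MatrixMultiplication.Theorems.GraphEquationsGenerators
import Summits.MatrixMultiplication.MatrixMultiplication.Theorems.GraphEquationsCostRank
import Summits.MatrixMultiplication.MatrixMultiplication.Theorems.GraphEquationsInitialForms
import Summits.MatrixMultiplication.MatrixMultiplication.Theorems.GraphEquationsPureForms
import Summits.MatrixMultiplication.MatrixMultiplication.Theorems.GraphEquationsPureFormsNec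

/-!
# `H_mult → H_init`, `S → H_init`, `H_init ↔ H_mult` unconditionally (`GraphEquations`, kernel M9c)

Decomp-mm node «GraphEquations» (lens 5); attacked leaf `MultiplicityReduction` (`H_mult`).
Target of the node, VERBATIM: `_root_.MatrixMultiplication`.

Critic SHARPEN s1 (STATUS l.1384) by name: `EqSystem.initNondegAt_two_of_reducedAt` — a system
reduced at a graph point `x` is initial-form nondegenerate of order `K = 2` at `x`, with LINEAR forms
`P_o = Σ_q J_C(x)_{o,q} F_q` and gradient matrix `G(γ) = J_C(x)` (constant in `γ`; `γ` ranges over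
the NORMAL space `ℂ^{n×n}` of `F`-coordinates, not over `W_n`).  Hence
`eqAdmissibleInit_of_red : EqAdmissibleRed β → EqAdmissibleInit β`,
`initialFormReduction_of_multiplicityReduction : H_mult → H_init`,
`nec_initialFormReduction : S → H_init`, and `initialFormReduction_iff_multiplicityReduction :
H_init ↔ H_mult` — the re-typing `H_init` is EQUIVALENT to the leaf as a Lean statement (what is
weaker is the PER-SYSTEM obligation `InitNondeg K ⊋ GenericallyReduced`), WEAKER-OR-EQUAL to `S`,
NEC.  Uses `weightedHomogeneousComponent_two_of_vanishing` (M9b).  No `sorry`.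
-/

set_option linter.dupNamespace false

noncomputable section

open scoped BigOperators

namespace Summit.MatrixMultiplication.MatrixMultiplication.Theorems.GraphEquations

open MvPolynomial
open Literature.Computability.AlgebraicComplexity

variable {n : ℕ}

/-- The gradient matrix of the linear forms `P_o = Σ_q J_{o,q} F_q` is `J`, at every `γ`. -/
theorem gradMatrix_linear {T : ℕ} (J : Matrix (Fin T) (Fin n × Fin n) ℂ)
    (γ : Fin n × Fin n → ℂ) :
    gradMatrix γ (fun o => ∑ q : Fin n × Fin n, J o q • (X q : MvPolynomial (Fin n × Fin n) ℂ)) =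
      J := by
  classical
  ext o q
  simp only [gradMatrix, Matrix.of_apply, map_sum, Derivation.map_smul, pderiv_X, smul_eval]
  rw [Finset.sum_eq_single_of_mem q (Finset.mem_univ q)]
  · simp
  · intro q' _ hq'
    simp [hq']

namespace EqSystem

/-- **Reduced at `x` ⇒ initial-form nondegenerate of order `2` at `x`** (`P_o` linear,
`G = J_C(x)`). -/
theorem initNondegAt_two_of_reducedAt {E : EqSystem n} (hE : E.Correct) {x : GraphVars n → ℂ}
    (hx : x ∈ mmGraph n) (hred : E.ReducedAt x) : E.InitNondegAt 2 x := by
  classical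
  refine ⟨fun _ => 2, fun o => ∑ q : Fin n × Fin n, E.jacobianC x o q • X q, 0, fun _ => le_rfl,
    fun o => ?_, ?_⟩
  · have hv : ∀ y ∈ mmGraph n, eval y (bind₁ (shift x) (E.testPoly (E.tests.get o))) = 0 :=
      fun y hy => eval_bind₁_shift_eq_zero hx
        (fun z hz => hE.eval_testPoly_eq_zero hz (List.get_mem _ _)) hy
    rw [weightedHomogeneousComponent_two_of_vanishing hv]
    simp only [map_sum, map_smul, aeval_X, coeff_inr_bind₁_shift]
    rfl
  · rw [gradMatrix_linear]
    exact hred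

/-- Generically reduced ⇒ initial-form nondegenerate of order `2`. -/
theorem initNondeg_two_of_genericallyReduced {E : EqSystem n} (hE : E.Correct)
    (h : E.GenericallyReduced) : E.InitNondeg 2 := by
  obtain ⟨x, hx, hred⟩ := h
  exact ⟨x, hx, initNondegAt_two_of_reducedAt hE hx hred⟩

end EqSystem

/-- `EqAdmissibleRed β → EqAdmissibleInit β`. -/
theorem eqAdmissibleInit_of_red {β : ℝ} (h : EqAdmissibleRed β) : EqAdmissibleInit β := by
  obtain ⟨c, hc⟩ := h
  refine ⟨2, c, fun n hn => ?_⟩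
  obtain ⟨E, hE, hred, hcost⟩ := hc n hn
  exact ⟨E, hE, EqSystem.initNondeg_two_of_genericallyReduced hE hred, hcost⟩

/-- **`H_mult → H_init`.** -/
theorem initialFormReduction_of_multiplicityReduction (h : MultiplicityReduction) :
    InitialFormReduction :=
  fun β hβ hE β' hβ' => eqAdmissibleInit_of_red (h β hβ hE β' hβ')

/-- **NEC: `S → H_init`.** -/
theorem nec_initialFormReduction (hS : _root_.MatrixMultiplication) : InitialFormReduction :=
  initialFormReduction_of_multiplicityReduction (nec_multiplicityReduction hS)

/-- **`H_init ↔ H_mult`** (unconditionally, by name). -/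
theorem initialFormReduction_iff_multiplicityReduction :
    InitialFormReduction ↔ MultiplicityReduction :=
  ⟨multiplicityReduction_of_initialFormReduction, initialFormReduction_of_multiplicityReduction⟩

/-- `H → H_mult` (reduced systems above `ω` come from optimal-exponent bilinear algorithms, M2). -/
theorem multiplicityReduction_of_equationsForceMultiplication (h : EquationsForceMultiplication) :
    MultiplicityReduction :=
  fun β hβ hE _ hβ' => eqAdmissibleRed_of_omega_lt (lt_of_le_of_lt (h β hβ hE) hβ')

/-- **`H_init ↔ H`** (unconditionally, by name). -/
theorem initialFormReduction_iff_equationsForceMultiplication :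
    InitialFormReduction ↔ EquationsForceMultiplication :=
  ⟨equationsForceMultiplication_of_initialFormReduction, fun h =>
    initialFormReduction_of_multiplicityReduction
      (multiplicityReduction_of_equationsForceMultiplication h)⟩

/-- The split `S ↔ V ∧ H_init` is exact. -/
theorem matrixMultiplication_iff_quadratic_and_initialFormReduction :
    _root_.MatrixMultiplication ↔ (GraphEquationsQuadratic ∧ InitialFormReduction) :=
  ⟨fun hS => ⟨nec_quadratic hS, nec_initialFormReduction hS⟩,
    fun h => matrixMultiplication_of_quadratic_of_initialFormReduction h.1 h.2⟩

end Summit.MatrixMultiplication.MatrixMultiplication.Theorems.GraphEquations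

end
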